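import Summits.QuantumFields.BalabanUV.Beta.SymmetrisedAxialGauge
import Literature.MathematicalPhysics.QuantumFieldTheory.Balaban1983to89.Beta.RootedComb

/-!
# `BalabanUV.Beta.SymmetrisedAxialReflection` — binder row D1, RULING R-D1-g25-1 step S1e: THE SYMMETRISED POTENTIAL, AVERAGING, TREE GAUGE AND
# PROJECTOR ARE REFLECTION-COVARIANT AT THE CENTRED ROOT (`L` odd, EVERY axis) — the hR half of the hyperoctahedral covariance of the re-based
# literal's Form-level objects (the hP half is S1∕S1d), by transporting an5∕an1's comb reflection lemmas (`RootedComb.axial_R1` & co.) along `P1 σ`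

HONEST FRAMING (cell contract, verbatim): «discharging `BetaPertH` makes Bałaban's UV stability UNCONDITIONAL — a real constructive-QFT
result; it is NOT the continuum limit and NOT the Clay problem.»  THIS MODULE DISCHARGES NOTHING of `BetaPertH` ∕ row D1: [folklore] finite
re-indexing on `ℤ^d` (Form level).  0 sorry, 0 `def … : Prop`, nothing cited as a fact; quotations are OBJECT LOCATORS.

WHAT.  [Balaban1987RG1] p.293 (5.7)∕(5.13): the reflection law of the polarization tensor; for the re-based literal «JsB12Sym» (JSB12SYM-SPINE v1 (F3)) the
reflection covariance of every ingredient is needed.  The S_d-symmetrised objects of S1∕S1d are sums over axis orders `σ` of the transported comb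
`axial (P1 σ A) (σ⁻¹•y) (σ⁻¹•x)`; each σ-comb is reflection-covariant because (i) the pull-back intertwines the reflections,
**`P1 σ (R1 α A) = R1 (σ⁻¹ α) (P1 σ A)`** (`P1_R1`; signs `reflSign` and re-based bond bases `bref` match under `psite σ`), and (ii) the cell's comb is
reflection-covariant in EVERY axis (`RootedComb.axial_R1`).  PROVED: `axialPerm_R1`, `symAxial_R1 : symAxial (R1 α A) y x = symAxial A (sref α y) (sref α x)`; at the
CENTRED root (`L` odd, [Balaban1987RG1] (0.3)): `SymLamAt_R1`, **`symLinAvgAt_R1 : symLinAvgAt (ctr d L) (R1 α A) L μ y = (R1 α (symLinAvgAt (ctr d L) A L)) μ y`**,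
`symTreeGaugeAt_R1`, **`symAxProjAt_R1 : symAxProjAt (ctr d L) L (R1 α A) = R1 α (symAxProjAt (ctr d L) L A)`**, `symAxialGaugeAt_R1` (the slice is reflection-invariant).
With S1's `symAxial_P1`∕`symLinAvgAt_ctr_P1` and S1d's `symAxProjAt_ctr_P1` this is the FULL hyperoctahedral covariance ((ℤ∕2)^d ⋊ S_d) of the symmetrised Form-level
objects — the comb has the (ℤ∕2)^d half only (`CombPermutationWitness`).
NOT HERE: kernels, tables, estimates, any identification with Bałaban's minimisers ∕ propagators ∕ β.  NOT D1, NOT BetaPertH, NOT continuum, NOT Clay.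
HONEST DEPENDENCY (verbatim): «continuum YM on T⁴ ⇐ BetaPertH ∧ nine spine estimates (0/9 proved); BetaPertH ⇐ (D1) ∧ (D4) ∧ CAP+tail;
G-an2-4 gates asym, D1 and NE2/3/4.»  ABSOLUTE RULE (cell, verbatim): «No internally-minted statement may enter as a cited fact. Every
hypothesis is either kernel-proved in this package or a verbatim quotation of a PUBLISHED theorem with page reference.»
Unit `b2b-balaban-beta-an2` gen 25 (row-D1 owner), 2026-08-21.
-/

namespace Summit.QuantumFields.BalabanUV.Beta.SymmetrisedAxialReflection

noncomputable section

open Finset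
open scoped BigOperators Nat
open Literature.MathematicalPhysics.QuantumFieldTheory.Balaban1983to89.Beta
open AffineAveraging (Form0 Form1 Site unitVec unitVec_apply dz box toSite contourSum)
open AveragingContours (grad axial blk)
open AveragingContoursRooted (ctr)
open PolarizationSign (reflSign axisReflect)
open ResolventReflection (sref sref_apply bref bref_apply R0 R1 R0_apply R1_apply reflSign_self reflSign_of_ne bflip bflip_mem sum_box_bflip
  sref_block contourSum_R1 dz_R0)
open RootedComb (sref_root_ctr blk_sref axial_R1 grad_R0 R1_sub)
open Summit.QuantumFields.BalabanUV.Beta.KernelPermutation (psite psite_apply psite_symm_apply)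
open Summit.QuantumFields.BalabanUV.Beta.ResolventPermutation (P0 P1 P0_apply P1_apply)
open Summit.QuantumFields.BalabanUV.Beta.SymmetrisedAxialPotential
open Summit.QuantumFields.BalabanUV.Beta.SymmetrisedAxialGauge

variable {d : ℕ}

/-! ## §1 The axis permutation intertwines the axis reflections -/

/-- [folklore] `σ•(sref α z) = sref (σ α) (σ•z)`. -/
theorem psite_sref (σ : Equiv.Perm (Fin d)) (α : Fin d) (z : Site d) : psite σ (sref α z) = sref (σ α) (psite σ z) := by
  funext i
  simp only [psite_apply, sref_apply, Equiv.symm_apply_eq]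

/-- [folklore] `σ⁻¹•(sref α z) = sref (σ⁻¹ α) (σ⁻¹•z)`. -/
theorem psite_symm_sref (σ : Equiv.Perm (Fin d)) (α : Fin d) (z : Site d) :
    (psite σ).symm (sref α z) = sref (σ.symm α) ((psite σ).symm z) := by
  funext i
  simp only [psite_symm_apply, sref_apply, Equiv.apply_eq_iff_eq_symm_apply]

/-- [folklore] `σ•(bref α κ z) = bref (σ α) (σ κ) (σ•z)` (re-based bond base points). -/
theorem psite_bref (σ : Equiv.Perm (Fin d)) (α κ : Fin d) (z : Site d) : psite σ (bref α κ z) = bref (σ α) (σ κ) (psite σ z) := by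
  funext i
  simp only [psite_apply, bref_apply, Equiv.symm_apply_eq, Equiv.apply_eq_iff_eq]

/-- [folklore] The leg sign is permutation-invariant: `reflSign (σ α) (σ κ) = reflSign α κ`. -/
theorem reflSign_perm (σ : Equiv.Perm (Fin d)) (α κ : Fin d) : reflSign (σ α) (σ κ) = reflSign α κ := by
  simp only [PolarizationSign.reflSign, Equiv.apply_eq_iff_eq]

/-- [folklore] **THE PULL-BACK INTERTWINES THE REFLECTIONS**: `P1 σ (R1 α A) = R1 (σ⁻¹ α) (P1 σ A)`. -/
theorem P1_R1 (σ : Equiv.Perm (Fin d)) (α : Fin d) (A : Form1 d ℝ) : P1 σ (R1 α A) = R1 (σ.symm α) (P1 σ A) := by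
  funext κ z
  simp only [P1_apply, R1_apply]
  rw [psite_bref, Equiv.apply_symm_apply, ← reflSign_perm σ (σ.symm α) κ, Equiv.apply_symm_apply]

/-! ## §2 Every σ-comb, hence the symmetrised potential, is reflection-covariant -/

/-- [folklore] **`A(Γ^σ)` UNDER A REFLECTION**: `axialPerm σ (R1 α A) y x = axialPerm σ A (sref α y) (sref α x)` — every axis order, every axis. -/
theorem axialPerm_R1 (σ : Equiv.Perm (Fin d)) (α : Fin d) (A : Form1 d ℝ) (y x : Site d) :
    axialPerm σ (R1 α A) y x = axialPerm σ A (sref α y) (sref α x) := by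
  simp only [axialPerm, P1_R1, axial_R1, psite_symm_sref]

/-- [folklore] **THE SYMMETRISED POTENTIAL UNDER A REFLECTION**: `symAxial (R1 α A) y x = symAxial A (sref α y) (sref α x)`. -/
theorem symAxial_R1 (α : Fin d) (A : Form1 d ℝ) (y x : Site d) : symAxial (R1 α A) y x = symAxial A (sref α y) (sref α x) := by
  simp only [symAxial, axialPerm_R1]

/-! ## §3 The centred rooted objects (`L` odd) -/

/-- [folklore] **THE CENTRED SYMMETRISED BLOCK POTENTIAL IS A REFLECTION SCALAR** (`L` odd): `SymLamAt ρ_c (R1 α A) L y = SymLamAt ρ_c A L (sref α y)`. -/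
theorem SymLamAt_R1 {L : ℕ} (hL : Odd L) (α : Fin d) (A : Form1 d ℝ) (y : Site d) :
    SymLamAt (ctr d L) (R1 α A) L y = SymLamAt (ctr d L) A L (sref α y) := by
  unfold SymLamAt
  have key : ∀ b ∈ box d L, symAxial (R1 α A) ((L : ℤ) • y + ctr d L) ((L : ℤ) • y + toSite b)
      = symAxial A ((L : ℤ) • sref α y + ctr d L) ((L : ℤ) • sref α y + toSite (bflip α L b)) := by
    intro b hb
    rw [symAxial_R1, sref_root_ctr hL, sref_block α hb]
  rw [Finset.sum_congr rfl key]
  exact sum_box_bflip α L (fun b => symAxial A ((L : ℤ) • sref α y + ctr d L) ((L : ℤ) • sref α y + toSite b))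

/-- [folklore] The same as an identity of block functions: `SymLamAt ρ_c (R1 α A) L = R0 α (SymLamAt ρ_c A L)`. -/
theorem SymLamAt_R1_eq {L : ℕ} (hL : Odd L) (α : Fin d) (A : Form1 d ℝ) : SymLamAt (ctr d L) (R1 α A) L = R0 α (SymLamAt (ctr d L) A L) := by
  funext y; rw [SymLamAt_R1 hL, R0_apply]

/-- [folklore] **THE CENTRED SYMMETRISED AVERAGING IS REFLECTION-COVARIANT** (`L` odd, EVERY axis `α`): the `μ`-component transforms with the leg sign
`reflSign α μ` at the re-based coarse bond `bref α μ y` — `symLinAvgAt ρ_c (R1 α A) L μ y = (R1 α (symLinAvgAt ρ_c A L)) μ y`. -/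
theorem symLinAvgAt_R1 {L : ℕ} (hL : Odd L) (α : Fin d) (A : Form1 d ℝ) (μ : Fin d) (y : Site d) :
    symLinAvgAt (ctr d L) (R1 α A) L μ y = R1 α (fun κ z => symLinAvgAt (ctr d L) A L κ z) μ y := by
  rw [R1_apply, symLinAvgAt_eq_contourSum_sub_dz, symLinAvgAt_eq_contourSum_sub_dz, contourSum_R1, R1_apply, SymLamAt_R1_eq hL, dz_R0,
    R1_apply]
  ring

/-- [folklore] **THE CENTRED SYMMETRISED TREE GAUGE IS A REFLECTION SCALAR** (`L` odd): `symTreeGaugeAt ρ_c (R1 α A) L = R0 α (symTreeGaugeAt ρ_c A L)`. -/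
theorem symTreeGaugeAt_R1 {L : ℕ} (hL : Odd L) (α : Fin d) (A : Form1 d ℝ) :
    symTreeGaugeAt (ctr d L) (R1 α A) L = R0 α (symTreeGaugeAt (ctr d L) A L) := by
  funext x
  rw [R0_apply, symTreeGaugeAt, symTreeGaugeAt, symAxial_R1, sref_root_ctr hL, blk_sref hL.pos]

/-- [folklore] **THE CENTRED SYMMETRISED AXIAL PROJECTOR IS REFLECTION-COVARIANT** (`L` odd, EVERY axis `α`):
`symAxProjAt ρ_c L (R1 α A) = R1 α (symAxProjAt ρ_c L A)` (with S1d's `symAxProjAt_ctr_P1`: full hyperoctahedral covariance). -/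
theorem symAxProjAt_R1 {L : ℕ} (hL : Odd L) (α : Fin d) (A : Form1 d ℝ) :
    symAxProjAt (ctr d L) L (R1 α A) = R1 α (symAxProjAt (ctr d L) L A) := by
  have hg : (fun x => (d ! : ℝ)⁻¹ * symTreeGaugeAt (ctr d L) (R1 α A) L x) = R0 α (fun x => (d ! : ℝ)⁻¹ * symTreeGaugeAt (ctr d L) A L x) := by
    funext x
    rw [R0_apply, symTreeGaugeAt_R1 hL, R0_apply]
  rw [symAxProjAt, symAxProjAt, hg, grad_R0, R1_sub]

/-- [folklore] The centred symmetrised axial gauge condition is reflection-invariant (`L` odd). -/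
theorem symAxialGaugeAt_R1 {L : ℕ} (hL : Odd L) (α : Fin d) {A : Form1 d ℝ} (hA : SymAxialGaugeAt (ctr d L) A L) :
    SymAxialGaugeAt (ctr d L) (R1 α A) L := by
  intro y b hb
  rw [symAxial_R1, sref_root_ctr hL, sref_block α hb]
  exact hA (sref α y) (bflip α L b) (bflip_mem α hb)

end

end Summit.QuantumFields.BalabanUV.Beta.SymmetrisedAxialReflection
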